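import Summits.CriticalPhenomena.Ising3DConformalLimit.Theorems.GapForcesFarMerging.Negative.SoftKernel

/-!
# `GapForcesFarMerging` is not soft, III: verdicts on families A, B, C

Part 3/4 — the three verdicts on the explicit families: family A has the GAP shape
(`κ = 1`, `C = 36`) and no far merging; family B has no GAP shape (its far merging, and family C, are in Part 4).

Split (Theorems files are ≤ 400 lines) of the theorem content of the standing adversary's work file
`Summits/CriticalPhenomena/Ising3DConformalLimit/Cruxes/GapForcesFarMerging/Disproof.lean`
(crux `stmt-CriticalPhenomena-4468`, route `EnergyNotSigmaSquared`), landed under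
`Theorems/GapForcesFarMerging/Negative/` so that ideators, planners and provers can import it.

## References

* M. Aizenman, Comm. Math. Phys. 86 (1982) 1–48 [AizenmanCMP1982].
* M. Aizenman, H. Duminil-Copin, Ann. Math. 194 (2021), §3 eqs. (3.7), (3.11)–(3.12)
  [AizenmanDuminilCopinAnnals2021].
* J. L. Lebowitz, Comm. Math. Phys. 35 (1974) 87–92 [Lebowitz1974].
* H. Duminil-Copin, R. Panis, arXiv:2404.05700, Thm 1.8 [DuminilCopinPanis2025LowerBounds].
-/

noncomputable section

namespace Summit.CriticalPhenomena.Ising3DConformalLimit.Theorems.GapForcesFarMerging.Negative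

open Literature.Probability.LatticeModels
open Summit.CriticalPhenomena.Ising3DConformalLimit.Theses.EnergyNotSigmaSquared

/-- `θ_A ≥ 0`. [folklore] -/
theorem θA_nonneg (y : Fin 4 → Site 3) : 0 ≤ θA y := by unfold θA; positivity

/-- `θ_A ≤ 1`. [folklore] -/
theorem θA_le_one (y : Fin 4 → Site 3) : θA y ≤ 1 := by
  unfold θA; exact inv_le_one_of_one_le₀ (le_max_left _ _)

/-- `θ_A` is admissible. [folklore] -/
theorem thetaHyp_A : ThetaHyp θA where
  nonneg := θA_nonneg
  le_one := θA_le_one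
  swap01 y := by unfold θA; rw [sep_comp_perm]
  swap12 y := by unfold θA; rw [sep_comp_perm]
  swap23 y := by unfold θA; rw [sep_comp_perm]
  transl y v := by unfold θA; rw [sep_transl]
  coincide a x z := by unfold θA; rw [sep_coincide]; simp

/-- `θ_B` is admissible. [folklore] -/
theorem thetaHyp_B : ThetaHyp θB where
  nonneg y := by unfold θB; split_ifs <;> norm_num
  le_one y := by unfold θB; split_ifs <;> norm_num
  swap01 y := by unfold θB; rw [sep_comp_perm]
  swap12 y := by unfold θB; rw [sep_comp_perm]
  swap23 y := by unfold θB; rw [sep_comp_perm]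
  transl y v := by unfold θB; rw [sep_transl]
  coincide a x z := by unfold θB; rw [sep_coincide]; simp

/-- `θ_C` is admissible. [folklore] -/
theorem thetaHyp_C : ThetaHyp θC where
  nonneg y := by
    unfold θC
    split_ifs
    · norm_num
    · exact θA_nonneg y
  le_one y := by
    unfold θC
    split_ifs
    · norm_num
    · exact θA_le_one y
  swap01 y := by unfold θC θA; rw [sep_comp_perm]
  swap12 y := by unfold θC θA; rw [sep_comp_perm]
  swap23 y := by unfold θC θA; rw [sep_comp_perm]
  transl y v := by unfold θC θA; rw [sep_transl]
  coincide a x z := by unfold θC θA; rw [sep_coincide]; simp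

/-- Distinct lattice points are at sup-distance `≥ 1`. [folklore] -/
theorem one_le_sep_of_injective {y : Fin 4 → Site 3} (hy : Function.Injective y) : 1 ≤ sep y :=
  le_sep fun _ _ hij => one_le_norm_of_ne_zero (sub_ne_zero.2 fun h => hij (hy h))

/-- Dilating an injective lattice quadruple by `L` makes all pairwise distances `≥ L`. [folklore] -/
theorem le_sep_smul {x : Fin 4 → Site 3} (hx : Function.Injective x) (L : ℕ) :
    (L : ℝ) ≤ sep (fun i => (L : ℤ) • x i) := by
  refine le_sep fun i j hij => ?_
  have h1 : (1 : ℝ) ≤ ‖x i - x j‖ := one_le_norm_of_ne_zero (sub_ne_zero.2 fun h => hij (hx h))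
  have : ‖(L : ℤ) • x i - (L : ℤ) • x j‖ = (L : ℝ) * ‖x i - x j‖ := by
    rw [← smul_sub, norm_smul]; simp
  rw [this]
  exact le_mul_of_one_le_right (Nat.cast_nonneg L) h1

/-- `‖e₂‖ = 1`. [folklore] -/
theorem norm_e₂ : ‖(e₂ : Site 3)‖ = 1 := by simp [Pi.norm_single]

/-- On the adjacent stratum `(0, e₂, x, x + e₂)` every `F_θ` has `θ`-independent Wick part and the
energy truncation equals `P₂ + P₃ − 2·Pmin·θ`. [folklore] -/
theorem adjacent_trunc_eq (θ : (Fin 4 → Site 3) → ℝ) (x : Site 3) :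
    Fθ θ ![0, e₂, x, x + e₂] - S₀ 0 e₂ * S₀ x (x + e₂) =
      g x * g x + g (x + e₂) * g (x - e₂) - 2 * pmin S₀ ![0, e₂, x, x + e₂] * θ ![0, e₂, x, x + e₂] := by
  have h1 : S₀ e₂ (x + e₂) = g x := by simp [S₀]
  have h2 : S₀ 0 (x + e₂) = g (x + e₂) := by simp [S₀]
  have h3 : S₀ e₂ x = g (x - e₂) := by simp [S₀]
  have h4 : S₀ 0 x = g x := by simp [S₀]
  simp only [Fθ, wick, P₁, P₂, P₃, Matrix.cons_val_zero, Matrix.cons_val_one, Matrix.cons_val, h1, h2,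
    h3, h4]
  ring

/-- The adjacent quadruple has `sep ≤ 1`. [folklore] -/
theorem sep_adjacent_le_one (x : Site 3) : sep ![0, e₂, x, x + e₂] ≤ 1 := by
  have h := sep_le_norm ![0, e₂, x, x + e₂] (i := 0) (j := 1) (by decide)
  simpa [norm_e₂] using h

/-- `Pmin` on the adjacent quadruple, in terms of `g`. [folklore] -/
theorem pmin_adjacent_eq (x : Site 3) :
    pmin S₀ ![0, e₂, x, x + e₂] = min (min (g e₂ * g e₂) (g x * g x)) (g (x + e₂) * g (x - e₂)) := by
  have h1 : S₀ e₂ (x + e₂) = g x := by simp [S₀]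
  have h2 : S₀ 0 (x + e₂) = g (x + e₂) := by simp [S₀]
  have h3 : S₀ e₂ x = g (x - e₂) := by simp [S₀]
  have h4 : S₀ 0 x = g x := by simp [S₀]
  have h5 : S₀ 0 e₂ = g e₂ := by simp [S₀]
  have h6 : S₀ x (x + e₂) = g e₂ := by simp [S₀]
  simp only [pmin, P₁, P₂, P₃, Matrix.cons_val_zero, Matrix.cons_val_one, Matrix.cons_val, h1, h2, h3, h4,
    h5, h6]

/-- `g(e₂) = 1/2`. [folklore] -/
theorem g_e₂ : g e₂ = 1 / 2 := by rw [g, norm_e₂]; norm_num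

/-- Unfolding `g`. [folklore] -/
theorem g_eq (x : Site 3) : g x = (1 + ‖x‖)⁻¹ := rfl

/-- For `u, v ∈ [m, M]`: `u + v - 2 min(u,v) = |u - v| ≤ M - m`. [folklore] -/
theorem two_min_le {u v m M : ℝ} (hu : m ≤ u) (hu' : u ≤ M) (hv : m ≤ v) (hv' : v ≤ M) :
    u + v - 2 * min u v ≤ M - m := by
  rcases le_total u v with h | h
  · rw [min_eq_left h]; linarith
  · rw [min_eq_right h]; linarith

/-- The elementary inequality `a⁻² - (2+a)⁻² ≤ 36 a⁻¹ (1+a)⁻²` for `a ≥ 1`. [folklore] -/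
theorem key_ineq {a : ℝ} (ha : 1 ≤ a) : (a ^ 2)⁻¹ - ((2 + a) ^ 2)⁻¹ ≤ 36 * a⁻¹ * ((1 + a) ^ 2)⁻¹ := by
  have ha0 : 0 < a := by linarith
  rw [show (a ^ 2)⁻¹ - ((2 + a) ^ 2)⁻¹ = (4 + 4 * a) / (a ^ 2 * (2 + a) ^ 2) by field_simp; ring]
  rw [show 36 * a⁻¹ * ((1 + a) ^ 2)⁻¹ = 36 / (a * (1 + a) ^ 2) by field_simp]
  rw [div_le_div_iff₀ (by positivity) (by positivity)]
  nlinarith [sq_nonneg a, mul_pos ha0 ha0, pow_pos ha0 3, pow_pos ha0 4,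
    mul_nonneg (by linarith : (0:ℝ) ≤ a - 1) (pow_pos ha0 3).le]

/-- **Family A satisfies the GAP shape** with `κ = 1`, `C = 36`. [folklore] -/
theorem gapShape_A : GapShape S₀ T₀ FA := by
  refine ⟨1, 36, one_pos, fun x hx => ?_⟩
  have ha := one_le_norm_of_ne_zero hx
  set a : ℝ := ‖x‖ with ha_def
  have ha0 : 0 < a := by linarith
  -- θ_A = 1 on the adjacent stratum
  have hθ : θA ![0, e₂, x, x + e₂] = 1 := by
    unfold θA; rw [max_eq_left (sep_adjacent_le_one x)]; simp
  have hT : T₀ x = g x := by simp [T₀, S₀]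
  rw [FA, adjacent_trunc_eq, hθ, mul_one, hT, Real.rpow_neg_one, pmin_adjacent_eq, g_e₂]
  have hgx : g x = (1 + a)⁻¹ := rfl
  -- norms of x ± e₂
  have hplus : a - 1 ≤ ‖x + e₂‖ ∧ ‖x + e₂‖ ≤ a + 1 := by
    constructor
    · have := norm_sub_norm_le x (x + e₂); simp [norm_e₂] at this; linarith
    · calc ‖x + e₂‖ ≤ ‖x‖ + ‖e₂‖ := norm_add_le _ _
        _ = a + 1 := by rw [norm_e₂]
  have hminus : a - 1 ≤ ‖x - e₂‖ ∧ ‖x - e₂‖ ≤ a + 1 := by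
    constructor
    · have := norm_sub_norm_le x (x - e₂); simp [norm_e₂] at this; linarith
    · calc ‖x - e₂‖ ≤ ‖x‖ + ‖e₂‖ := norm_sub_le _ _
        _ = a + 1 := by rw [norm_e₂]
  have hg_le : ∀ v : Site 3, g v ≤ 1 := g_le_one
  have hpmin0 : 0 ≤ min (min (1 / 2 * (1 / 2)) (g x * g x)) (g (x + e₂) * g (x - e₂)) :=
    le_min (le_min (by norm_num) (mul_nonneg (g_pos _).le (g_pos _).le))
      (mul_nonneg (g_pos _).le (g_pos _).le)
  rcases le_or_gt a 2 with h2 | h2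
  · -- small x: absorbed by C
    have hL : g x * g x + g (x + e₂) * g (x - e₂) -
        2 * min (min (1 / 2 * (1 / 2)) (g x * g x)) (g (x + e₂) * g (x - e₂)) ≤ 2 := by
      nlinarith [hg_le x, hg_le (x + e₂), hg_le (x - e₂), g_pos x, g_pos (x + e₂), g_pos (x - e₂)]
    refine hL.trans ?_
    rw [hgx]
    have h3 : (1 / 2 : ℝ) ≤ a⁻¹ := by rw [one_div]; exact inv_anti₀ ha0 h2
    have h4 : (1 / 9 : ℝ) ≤ ((1 + a)⁻¹) ^ 2 := by
      rw [inv_pow, one_div]; exact inv_anti₀ (by positivity) (by nlinarith)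
    nlinarith
  · -- large x: |P₂ - P₃| ≤ a⁻² - (2+a)⁻² ≤ 36 a⁻¹ (1+a)⁻²
    have hgp : g (x + e₂) ≤ a⁻¹ ∧ (2 + a)⁻¹ ≤ g (x + e₂) := by
      rw [g_eq]; constructor
      · exact inv_anti₀ ha0 (by linarith [hplus.1])
      · exact inv_anti₀ (by positivity) (by linarith [hplus.2])
    have hgm : g (x - e₂) ≤ a⁻¹ ∧ (2 + a)⁻¹ ≤ g (x - e₂) := by
      rw [g_eq]; constructor
      · exact inv_anti₀ ha0 (by linarith [hminus.1])
      · exact inv_anti₀ (by positivity) (by linarith [hminus.2])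
    have hP2le : g x * g x ≤ 1 / 2 * (1 / 2) := by
      rw [hgx]
      have : (1 + a)⁻¹ ≤ 1 / 2 := by rw [one_div]; exact inv_anti₀ (by norm_num) (by linarith)
      have h0 : 0 ≤ (1 + a)⁻¹ := by positivity
      nlinarith
    rw [min_eq_right hP2le]
    have hm : ((2 + a) ^ 2)⁻¹ ≤ g x * g x ∧ g x * g x ≤ (a ^ 2)⁻¹ := by
      rw [hgx, ← mul_inv, ← sq]; constructor
      · exact inv_anti₀ (by positivity) (by nlinarith)
      · exact inv_anti₀ (by positivity) (by nlinarith)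
    have hm' : ((2 + a) ^ 2)⁻¹ ≤ g (x + e₂) * g (x - e₂) ∧ g (x + e₂) * g (x - e₂) ≤ (a ^ 2)⁻¹ := by
      constructor
      · calc ((2 + a) ^ 2)⁻¹ = (2 + a)⁻¹ * (2 + a)⁻¹ := by rw [sq, mul_inv]
          _ ≤ g (x + e₂) * g (x - e₂) :=
            mul_le_mul hgp.2 hgm.2 (by positivity) (g_pos _).le
      · calc g (x + e₂) * g (x - e₂) ≤ a⁻¹ * a⁻¹ :=
            mul_le_mul hgp.1 hgm.1 (g_pos _).le (by positivity)
          _ = (a ^ 2)⁻¹ := by rw [sq, mul_inv]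
    calc g x * g x + g (x + e₂) * g (x - e₂) - 2 * min (g x * g x) (g (x + e₂) * g (x - e₂))
        ≤ (a ^ 2)⁻¹ - ((2 + a) ^ 2)⁻¹ := two_min_le hm.1 hm.2 hm'.1 hm'.2
      _ ≤ 36 * a⁻¹ * ((1 + a) ^ 2)⁻¹ := key_ineq ha
      _ = 36 * a⁻¹ * g x ^ 2 := by rw [hgx, inv_pow]

/-- A deformation that decays like `1/sep` in the bulk never produces far merging. [folklore] -/
theorem not_farMergingShape_of_decay {θ : (Fin 4 → Site 3) → ℝ} (hθ0 : ∀ y, 0 ≤ θ y)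
    (hdecay : ∀ y, 2 ≤ sep y → θ y ≤ (sep y)⁻¹) : ¬ FarMergingShape S₀ (Fθ θ) := by
  rintro ⟨c, hc, x, hx, h⟩
  obtain ⟨L₀, hL₀⟩ := exists_nat_gt (max 2 (2 / c))
  obtain ⟨L, hL, hin⟩ := h L₀
  set y : Fin 4 → Site 3 := fun i => (L : ℤ) • x i with hy
  have hLr : max 2 (2 / c) < (L : ℝ) := lt_of_lt_of_le hL₀ (by exact_mod_cast hL)
  have hL2 : (2 : ℝ) ≤ L := ((le_max_left _ _).trans hLr.le)
  have hLc : 2 / c < (L : ℝ) := lt_of_le_of_lt (le_max_right _ _) hLr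
  have hsep : (L : ℝ) ≤ sep y := le_sep_smul hx L
  have hθle : θ y ≤ (L : ℝ)⁻¹ :=
    (hdecay y (hL2.trans hsep)).trans (inv_anti₀ (by linarith) hsep)
  change Fθ θ y - (S₀ (y 0) (y 1) * S₀ (y 2) (y 3) + S₀ (y 0) (y 2) * S₀ (y 1) (y 3)
      + S₀ (y 0) (y 3) * S₀ (y 1) (y 2)) ≤ -(c * (S₀ (y 0) (y 1) * S₀ (y 2) (y 3))) at hin
  rw [Fθ_sub_wick] at hin
  have hP1 : 0 < S₀ (y 0) (y 1) * S₀ (y 2) (y 3) := mul_pos (S₀_pos _ _) (S₀_pos _ _)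
  have hmin : pmin S₀ y ≤ S₀ (y 0) (y 1) * S₀ (y 2) (y 3) := pmin_le_P₁ y
  have hm0 := pmin_nonneg y
  have hθ0' := hθ0 y
  -- c·P₁ ≤ 2·Pmin·θ ≤ 2·P₁/L, hence c ≤ 2/L < c
  have h1 : c * (S₀ (y 0) (y 1) * S₀ (y 2) (y 3)) ≤ 2 * (S₀ (y 0) (y 1) * S₀ (y 2) (y 3)) * (L : ℝ)⁻¹ := by
    nlinarith [mul_le_mul hmin hθle hθ0' hP1.le]
  have h2 : c ≤ 2 * (L : ℝ)⁻¹ :=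
    le_of_mul_le_mul_right
      (show c * (S₀ (y 0) (y 1) * S₀ (y 2) (y 3)) ≤ 2 * (L : ℝ)⁻¹ * (S₀ (y 0) (y 1) * S₀ (y 2) (y 3)) by
        linarith [h1]) hP1
  have hL0 : (0 : ℝ) < L := by linarith
  rw [div_lt_iff₀ hc] at hLc
  have : c * (L : ℝ) ≤ 2 := by
    have := mul_le_mul_of_nonneg_right h2 hL0.le
    rwa [mul_assoc, inv_mul_cancel₀ hL0.ne', mul_one] at this
  linarith [mul_comm c (L : ℝ)]

/-- **Family A has no far merging.** [folklore] -/
theorem not_farMergingShape_A : ¬ FarMergingShape S₀ FA :=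
  not_farMergingShape_of_decay θA_nonneg fun y hy => by
    unfold θA; rw [max_eq_right (by linarith)]

/-- `‖e₁‖ = 1`. [folklore] -/
theorem norm_e₁ : ‖(e₁ : Site 3)‖ = 1 := by simp [Pi.norm_single]

/-- A quadruple with pairwise distinct entries is injective. [folklore] -/
theorem injective_vec4 {α : Type*} {a b c d : α} (hab : a ≠ b) (hac : a ≠ c) (had : a ≠ d)
    (hbc : b ≠ c) (hbd : b ≠ d) (hcd : c ≠ d) : Function.Injective ![a, b, c, d] := by
  intro i j h
  fin_cases i <;> fin_cases j <;> simp at h ⊢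
  all_goals first
    | exact absurd h hab
    | exact absurd h.symm hab
    | exact absurd h hac
    | exact absurd h.symm hac
    | exact absurd h had
    | exact absurd h.symm had
    | exact absurd h hbc
    | exact absurd h.symm hbc
    | exact absurd h hbd
    | exact absurd h.symm hbd
    | exact absurd h hcd
    | exact absurd h.symm hcd

/-- The adjacent quadruple at `x = n e₁` is injective for `n ≥ 1`. [folklore] -/
theorem injective_adjacent (n : ℕ) (hn : 1 ≤ n) :
    Function.Injective ![(0 : Site 3), e₂, (n : ℤ) • e₁, (n : ℤ) • e₁ + e₂] := by
  have hn0 : (n : ℤ) ≠ 0 := by exact_mod_cast Nat.one_le_iff_ne_zero.1 hn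
  refine injective_vec4 ?_ ?_ ?_ ?_ ?_ ?_
  · intro h; simpa using congrFun h 1
  · intro h; have := congrFun h 0; simp at this; exact hn0 this.symm
  · intro h; simpa using congrFun h 1
  · intro h; simpa using congrFun h 1
  · intro h; have := congrFun h 0; simp at this; exact hn0 this.symm
  · intro h; simpa using congrFun h 1

/-- The adjacent quadruple at `x = n e₁`, `n ≥ 1`, has `sep = 1`. [folklore] -/
theorem sep_adjacent_eq_one (n : ℕ) (hn : 1 ≤ n) : sep ![(0 : Site 3), e₂, (n : ℤ) • e₁, (n : ℤ) • e₁ + e₂] = 1 :=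
  le_antisymm (sep_adjacent_le_one _) (one_le_sep_of_injective (injective_adjacent n hn))

/-- A deformation with `θ ≤ 1/2` on the adjacent quadruples at `x = n e₁` violates the GAP shape:
there the energy truncation is `≥ P₂ = g(x)²`, not `o(g(x)²)`. [folklore] -/
theorem not_gapShape_of_half {θ : (Fin 4 → Site 3) → ℝ} (hθ0 : ∀ y, 0 ≤ θ y)
    (hhalf : ∀ n : ℕ, 2 ≤ n → θ ![0, e₂, (n : ℤ) • e₁, (n : ℤ) • e₁ + e₂] ≤ 1 / 2) :
    ¬ GapShape S₀ T₀ (Fθ θ) := by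
  rintro ⟨κ, C, hκ, h⟩
  -- pick n ≥ 2 with C < n^κ
  obtain ⟨n, hn⟩ := exists_nat_gt (max 2 (|C| ^ (1 / κ)))
  have h2 : (2 : ℝ) < n := lt_of_le_of_lt (le_max_left _ _) hn
  have hn2 : 2 ≤ n := by exact_mod_cast h2.le
  have hCn : C < (n : ℝ) ^ κ := by
    have hb : |C| ^ (1 / κ) < n := lt_of_le_of_lt (le_max_right _ _) hn
    have h0 : 0 ≤ |C| ^ (1 / κ) := Real.rpow_nonneg (abs_nonneg _) _
    have := Real.rpow_lt_rpow h0 hb hκ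
    rw [← Real.rpow_mul (abs_nonneg _), show (1 / κ) * κ = 1 by field_simp, Real.rpow_one] at this
    exact lt_of_le_of_lt (le_abs_self C) this
  set x : Site 3 := (n : ℤ) • e₁ with hx_def
  have hxnorm : ‖x‖ = n := by rw [hx_def, norm_smul, norm_e₁]; simp
  have hn0 : (0 : ℝ) < n := by linarith
  have hx0 : x ≠ 0 := by
    intro h0; rw [h0, norm_zero] at hxnorm; exact hn0.ne' (by exact_mod_cast hxnorm.symm)
  have hmain := h x hx0
  rw [adjacent_trunc_eq, pmin_adjacent_eq] at hmain
  have hT : T₀ x = g x := by simp [T₀, S₀]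
  rw [hT, hxnorm] at hmain
  have hθ := hhalf n hn2
  have hθ0' := hθ0 ![0, e₂, (n : ℤ) • e₁, (n : ℤ) • e₁ + e₂]
  have hminle : min (min (g e₂ * g e₂) (g x * g x)) (g (x + e₂) * g (x - e₂)) ≤ g (x + e₂) * g (x - e₂) :=
    min_le_right _ _
  have hmin0 : 0 ≤ min (min (g e₂ * g e₂) (g x * g x)) (g (x + e₂) * g (x - e₂)) :=
    le_min (le_min (mul_nonneg (g_pos _).le (g_pos _).le) (mul_nonneg (g_pos _).le (g_pos _).le))
      (mul_nonneg (g_pos _).le (g_pos _).le)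
  -- hence g x² ≤ C n^{-κ} g x², so 1 ≤ C n^{-κ}
  have hgx : 0 < g x := g_pos x
  have h1 : g x * g x ≤ C * (n : ℝ) ^ (-κ) * g x ^ 2 := by
    nlinarith [mul_nonneg hmin0 hθ0', mul_nonneg (mul_nonneg (g_pos (x + e₂)).le (g_pos (x - e₂)).le) hθ0']
  have h2' : 1 ≤ C * (n : ℝ) ^ (-κ) := by
    rw [sq] at h1
    exact le_of_mul_le_mul_right (by linarith) (mul_pos hgx hgx)
  have hpos : 0 < (n : ℝ) ^ κ := Real.rpow_pos_of_pos hn0 κ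
  rw [Real.rpow_neg hn0.le] at h2'
  have := mul_le_mul_of_nonneg_right h2' hpos.le
  rw [one_mul, mul_assoc, inv_mul_cancel₀ hpos.ne', mul_one] at this
  linarith

/-- **Family B violates the GAP shape.** [folklore] -/
theorem not_gapShape_B : ¬ GapShape S₀ T₀ FB :=
  not_gapShape_of_half thetaHyp_B.nonneg fun n hn => by
    unfold θB
    rw [sep_adjacent_eq_one n (by omega)]
    norm_num

end Summit.CriticalPhenomena.Ising3DConformalLimit.Theorems.GapForcesFarMerging.Negative

end
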